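import Literature.Analysis.FunctionSpaces.TorusLerayHelmholtzH1
import Literature.Analysis.FunctionSpaces.TorusSobolevInterpolationCS
import Literature.Analysis.FunctionSpaces.TorusGevreySobolevBounds
import Literature.Analysis.FunctionSpaces.TorusConvectionLaplacianNormSq
import Literature.Analysis.FunctionSpaces.TorusClassicalNSDifferenceBalances
import Literature.Analysis.FunctionSpaces.TorusClassicalNSSecondVariation
import HarnessLib

/-!
# Hölder continuity in `H¹` of the projected Navier–Stokes vector field on Gevrey balls of `T³`

Analysis/FluidPDE proof file (theorems only; no definitions, no named facts). In the functional form of the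
incompressible Navier–Stokes equations on the flat torus (Constantin–Foias 1988, Ch. 5; Robinson–Rodrigo–Sadowski
2016, Ch. 5) the right-hand side is the **projected vector field**

  `G(u) = νΔu − P((u·∇)u)`,   `P v = v − ∇Δ⁻¹ div v`

(`P` the smooth Leray–Helmholtz projection, `FunctionSpaces/TorusLerayHelmholtzH1.lean`; on smooth zero-mean
divergence-free `u` the Stokes operator is `−PΔ = −Δ`). This file proves that on a **Gevrey ball**
`{u smooth, ∫u = 0, ∑_{k∈S} e^{2σ|k|} ‖û(k)‖² ≤ C ∀ S}` (`σ > 0`; the classes `D(e^{σA^{1/2}})` of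
Foias–Temam 1989) the map `u ↦ G(u)` is **Hölder-½ continuous into `H¹`**:

  `‖G(u₁) − G(u₂)‖²_{L²} + ‖∇(G(u₁) − G(u₂))‖²_{L²} ≤ K · (‖u₁ − u₂‖²_{L²} + ‖∇(u₁ − u₂)‖²_{L²})^{1/2}`

with `K = K(ν, σ, C)` (`Torus.exists_h1_nsVectorField_sub_le_sqrt_of_gevreyBound`, `card d = 3`). The proof is the
textbook chain (RRS 2016, proof of Thm 7.1 / (7.3): `H^k(T³)` product estimates; Constantin–Foias 1988, Ch. 6 and
(4.13)–(4.14): interpolation), assembled from tree lemmas: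

1. *Algebra* (`Torus.nsVectorField_sub_apply`): with `δ = u₁ − u₂`,
   `G(u₁) − G(u₂) = νΔδ − P V`, `V = (u₁·∇)δ + (δ·∇)u₂` (bilinearity of `(·∇)·`, linearity of `Δ`, `P`).
2. *`H¹` bookkeeping* (`Torus.h1_nsVectorField_sub_le`): `‖·‖²_{H¹} ≤ 2ν²(‖Δδ‖₂² + ‖∇Δδ‖₂²) + 2‖V‖²_{H¹}`,
   by the `L²`- and `H¹`-contractivity of `P` (`TorusLerayHelmholtzH1`).
3. *Product estimates* (`Torus.h1_convect_add_convect_le`, every `d`): with sup bounds `‖u₁‖ ≤ M`,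
   `‖∂ₖu₁‖, ‖∂ₖu₂‖ ≤ Λ`, `‖δ‖ ≤ M₀`,
   `‖V‖²_{H¹} ≤ 2d²Λ² ‖δ‖₂² + (2dM² + 8d²Λ²) ‖∇δ‖₂² + 4dM² ‖Δδ‖₂² + 4dM₀² ‖Δu₂‖₂²`
   (`Torus.integral_norm_sq_convect_add_convect_le` and the transport / stretching shapes
   `Torus.gradNormSq_convect_le_of_norm_left_le` / `…_right_le`); on `T³` the sup norm of the zero-mean `δ`
   is `M₀² ≤ K₃(‖∇δ‖₂² + ‖Δδ‖₂²)` (`Torus.norm_sq_le_gradNormSq_add_of_hasZeroMean`), and `M, Λ, ‖Δu₂‖₂²` are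
   bounded on the Gevrey ball (`Torus.exists_sobolevBounds_of_gevreyBound`). Net:
   `LHS ≤ K₀ (‖δ‖₂² + ‖∇δ‖₂² + ‖Δδ‖₂² + ‖∇Δδ‖₂²)`.
4. *Interpolation down to `H¹`* (`TorusSobolevInterpolationCS`): `‖Δδ‖₂² ≤ ‖∇δ‖₂ ‖∇Δδ‖₂`,
   `‖∇Δδ‖₂² ≤ ‖∇δ‖₂ ‖∇Δ²δ‖₂`, where `‖∇Δδ‖₂², ‖∇Δ²δ‖₂²` are bounded on the Gevrey ball
   (`Torus.gradNormSq_laplacian_laplacian_le_of_gevreyBound`: the fifth spectral moment against the Gevrey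
   majorant), and `‖δ‖²_{H¹} = h² ≤ h_max · h` on the (bounded) ball; hence `LHS ≤ K h`, `h = ‖δ‖_{H¹}`.

## Mathlib / tree search

Tree (reused, see the docstrings): `TorusLerayHelmholtzH1` (linearity and `L²`/`H¹` contractivity of `P`),
`TorusClassicalNSSecondVariation` (`convect_self_sub_convect_self`), `TorusClassicalNSDifferenceBalances`
(`integral_norm_sq_convect_add_convect_le`), `TorusConvectionLaplacianNormSq` (transport / stretching shapes),
`TorusConvectionGradNormSq` (sup bound of zero-mean fields on `T³`), `TorusGevreySobolevBounds`,
`TorusSobolevInterpolationCS`; Mathlib `hasSum_le_of_sum_le`, `Real.le_sqrt_of_sq_le`, `Real.sqrt_le_sqrt`.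
Searched `nsVectorField`, `Holder.*Gevrey`, `gradNormSq.*leray`, `convect_add_convect.*gradNormSq`: no continuity
estimate of the projected vector field in the tree.

## References

* J. C. Robinson, J. L. Rodrigo, W. Sadowski, *The Three-Dimensional Navier–Stokes Equations*, CUP 2016,
  Thm. 2.6, Lemma 2.9 (Leray projector), proof of Thm 7.1 ((7.3), product estimates). [RobinsonRodrigoSadowskiCUP2016]
* P. Constantin, C. Foias, *Navier–Stokes Equations*, Univ. Chicago Press 1988, Ch. 4 ((4.13)–(4.14)), Ch. 5–6.
  [ConstantinFoiasNSE1988]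
* C. Foias, R. Temam, J. Funct. Anal. 87 (1989), 359–369 (Gevrey classes). [FoiasTemam1989]
-/

noncomputable section

open _root_.MeasureTheory Set Filter Function UnitAddTorus
open scoped InnerProductSpace ContDiff Topology BigOperators

namespace Literature.Analysis.FluidPDE

namespace Torus

open Literature.Analysis.FunctionSpaces Literature.Analysis.FunctionSpaces.Torus

variable {d : Type*} [Fintype d] [DecidableEq d]

/-! ### Elementary `L²` / `H¹` bookkeeping on `T^d` -/

section Bookkeeping

variable {f g : UnitAddTorus d → EuclideanSpace ℝ d}

/-- `‖∇(−f)‖₂² = ‖∇f‖₂²` (pointwise `∂ᵢ(−f) = −∂ᵢf`, junk values included). [folklore] -/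
theorem gradNormSq_fun_neg (f : UnitAddTorus d → EuclideanSpace ℝ d) :
    gradNormSq (fun x => -f x) = gradNormSq f := by
  unfold gradNormSq
  congr 1; funext x
  refine Finset.sum_congr rfl fun i _ => ?_
  rw [partialDeriv_neg, norm_neg]

/-- `‖∇(f − g)‖₂² ≤ 2‖∇f‖₂² + 2‖∇g‖₂²` for smooth fields. [folklore] -/
theorem gradNormSq_fun_sub_le (hf : IsSmooth f) (hg : IsSmooth g) :
    gradNormSq (fun x => f x - g x) ≤ 2 * gradNormSq f + 2 * gradNormSq g := by
  have h : (fun x => f x - g x) = f + fun x => -g x := by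
    funext x; simp [sub_eq_add_neg]
  have h2 := gradNormSq_add_le hf (show IsSmooth (fun x => -g x) from hg.neg)
  rw [gradNormSq_fun_neg] at h2
  rw [h]
  exact h2

/-- `‖∇(c • f)‖₂² = c² ‖∇f‖₂²` for a smooth field and a real constant. [folklore] -/
theorem gradNormSq_fun_const_smul (hf : IsSmooth f) (c : ℝ) :
    gradNormSq (fun x => c • f x) = c ^ 2 * gradNormSq f := by
  unfold gradNormSq
  rw [← integral_const_mul]
  congr 1; funext x
  rw [Finset.mul_sum]
  refine Finset.sum_congr rfl fun i _ => ?_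
  rw [show (fun x => c • f x) = c • f from rfl, partialDeriv_const_smul (hf.isContDiff (by simp)) c i,
    Pi.smul_apply, norm_smul, mul_pow, Real.norm_eq_abs, sq_abs]

omit [DecidableEq d] in
/-- `∫ ‖c • f‖² = c² ∫ ‖f‖²`. [folklore] -/
theorem integral_norm_sq_const_smul (f : UnitAddTorus d → EuclideanSpace ℝ d) (c : ℝ) :
    ∫ x, ‖c • f x‖ ^ 2 = c ^ 2 * ∫ x, ‖f x‖ ^ 2 := by
  rw [← integral_const_mul]
  congr 1; funext x
  rw [norm_smul, mul_pow, Real.norm_eq_abs, sq_abs]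

omit [DecidableEq d] in
/-- `∫ ‖f − g‖² ≤ 2∫‖f‖² + 2∫‖g‖²` for smooth fields (pointwise parallelogram bound). [folklore] -/
theorem integral_norm_sq_fun_sub_le (hf : IsSmooth f) (hg : IsSmooth g) :
    ∫ x, ‖f x - g x‖ ^ 2 ≤ 2 * (∫ x, ‖f x‖ ^ 2) + 2 * ∫ x, ‖g x‖ ^ 2 := by
  have hpt : ∀ x, ‖f x - g x‖ ^ 2 ≤ 2 * ‖f x‖ ^ 2 + 2 * ‖g x‖ ^ 2 := fun x => by
    have h := norm_sub_le (f x) (g x)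
    nlinarith [norm_nonneg (f x - g x), norm_nonneg (f x), norm_nonneg (g x), sq_nonneg (‖f x‖ - ‖g x‖)]
  have hi := (hf.sub hg).norm_sq.integrable
  calc ∫ x, ‖f x - g x‖ ^ 2 ≤ ∫ x, (2 * ‖f x‖ ^ 2 + 2 * ‖g x‖ ^ 2) :=
        integral_mono hi ((hf.norm_sq.integrable.const_mul 2).add (hg.norm_sq.integrable.const_mul 2)) hpt
    _ = 2 * (∫ x, ‖f x‖ ^ 2) + 2 * ∫ x, ‖g x‖ ^ 2 := by
        rw [integral_add (hf.norm_sq.integrable.const_mul 2) (hg.norm_sq.integrable.const_mul 2),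
          integral_const_mul, integral_const_mul]

end Bookkeeping

/-! ### The difference of two values of the projected vector field -/

section VectorField

variable {u₁ u₂ : UnitAddTorus d → EuclideanSpace ℝ d}

/-- **Algebra of the difference**: for smooth `u₁, u₂` and `δ = u₁ − u₂`,
`G(u₁) − G(u₂) = νΔδ − P V` pointwise, where `G(u) = νΔu − P((u·∇)u)`, `P v = v − ∇Δ⁻¹div v` and
`V = (u₁·∇)δ + (δ·∇)u₂` (`(u₁·∇)u₁ − (u₂·∇)u₂ = (u₁·∇)δ + (δ·∇)u₂`, `Δ` and `P` linear). [folklore] -/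
theorem nsVectorField_sub_apply (ν : ℝ) (hu₁ : IsSmooth u₁) (hu₂ : IsSmooth u₂) (x : UnitAddTorus d) :
    (ν • laplacian u₁ x - (convect u₁ u₁ x - Torus.gradient (invLaplacian (divergence (convect u₁ u₁))) x)) -
        (ν • laplacian u₂ x - (convect u₂ u₂ x - Torus.gradient (invLaplacian (divergence (convect u₂ u₂))) x)) =
      ν • laplacian (fun y => u₁ y - u₂ y) x -
        ((convect u₁ (fun z => u₁ z - u₂ z) x + convect (fun z => u₁ z - u₂ z) u₂ x) -
          Torus.gradient (invLaplacian (divergence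
            (fun y => convect u₁ (fun z => u₁ z - u₂ z) y + convect (fun z => u₁ z - u₂ z) u₂ y))) x) := by
  have hN₁ : IsSmooth (convect u₁ u₁) := hu₁.convect hu₁
  have hN₂ : IsSmooth (convect u₂ u₂) := hu₂.convect hu₂
  have hV : convect u₁ u₁ - convect u₂ u₂ =
      fun y => convect u₁ (fun z => u₁ z - u₂ z) y + convect (fun z => u₁ z - u₂ z) u₂ y := by
    funext y
    exact convect_self_sub_convect_self (hu₁.isContDiff (by simp)) (hu₂.isContDiff (by simp)) y
  have hΔ : laplacian (fun y => u₁ y - u₂ y) x = laplacian u₁ x - laplacian u₂ x := by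
    rw [show (fun y => u₁ y - u₂ y) = u₁ - u₂ from rfl, laplacian_sub hu₁ hu₂, Pi.sub_apply]
  have hVx : convect u₁ (fun z => u₁ z - u₂ z) x + convect (fun z => u₁ z - u₂ z) u₂ x =
      (convect u₁ u₁ - convect u₂ u₂) x := by rw [hV]
  rw [hΔ, hVx, ← hV, ← sub_gradient_invLaplacian_divergence_sub hN₁ hN₂ x, smul_sub]
  abel

/-- **`H¹` bookkeeping of the difference**: for smooth `u₁, u₂` on `T^d` (`d` nonempty), with
`δ = u₁ − u₂` and `V = (u₁·∇)δ + (δ·∇)u₂`,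
`‖G(u₁) − G(u₂)‖₂² + ‖∇(G(u₁) − G(u₂))‖₂² ≤ 2ν² (‖Δδ‖₂² + ‖∇Δδ‖₂²) + 2 (‖V‖₂² + ‖∇V‖₂²)`
(`Torus.nsVectorField_sub_apply`, `(a − b)² ≤ 2a² + 2b²`, and the `L²`/`H¹` contractivity of `P`,
Robinson–Rodrigo–Sadowski 2016, Thm. 2.6 with Lemma 2.9). [folklore] -/
theorem h1_nsVectorField_sub_le [Nonempty d] (ν : ℝ) (hu₁ : IsSmooth u₁) (hu₂ : IsSmooth u₂) :
    (∫ x, ‖(ν • laplacian u₁ x - (convect u₁ u₁ x - Torus.gradient (invLaplacian (divergence (convect u₁ u₁))) x)) -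
        (ν • laplacian u₂ x - (convect u₂ u₂ x - Torus.gradient (invLaplacian (divergence (convect u₂ u₂))) x))‖ ^ 2) +
      gradNormSq (fun x => (ν • laplacian u₁ x -
          (convect u₁ u₁ x - Torus.gradient (invLaplacian (divergence (convect u₁ u₁))) x)) -
        (ν • laplacian u₂ x - (convect u₂ u₂ x - Torus.gradient (invLaplacian (divergence (convect u₂ u₂))) x))) ≤
      2 * ν ^ 2 * ((∫ x, ‖laplacian (fun y => u₁ y - u₂ y) x‖ ^ 2) + gradNormSq (laplacian (fun y => u₁ y - u₂ y))) +
        2 * ((∫ x, ‖convect u₁ (fun z => u₁ z - u₂ z) x + convect (fun z => u₁ z - u₂ z) u₂ x‖ ^ 2) +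
          gradNormSq (fun x => convect u₁ (fun z => u₁ z - u₂ z) x + convect (fun z => u₁ z - u₂ z) u₂ x)) := by
  have hδ : IsSmooth (fun y => u₁ y - u₂ y) := hu₁.sub hu₂
  have hV : IsSmooth (fun y => convect u₁ (fun z => u₁ z - u₂ z) y + convect (fun z => u₁ z - u₂ z) u₂ y) :=
    (hu₁.convect hδ).add (hδ.convect hu₂)
  have hP := isSmooth_sub_gradient_invLaplacian_divergence hV
  have hΔ : IsSmooth (fun x => ν • laplacian (fun y => u₁ y - u₂ y) x) := hδ.laplacian.smul ν
  simp only [nsVectorField_sub_apply ν hu₁ hu₂]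
  have h1 := integral_norm_sq_fun_sub_le hΔ hP
  have h2 := gradNormSq_fun_sub_le hΔ hP
  have h3 := integral_norm_sq_sub_gradient_invLaplacian_divergence_le hV
  have h4 := gradNormSq_sub_gradient_invLaplacian_divergence_le hV
  rw [integral_norm_sq_const_smul] at h1
  rw [gradNormSq_fun_const_smul hδ.laplacian] at h2
  nlinarith [h1, h2, h3, h4, sq_nonneg ν]

/-- **`H¹` product estimate for the linearised inertial term, every dimension**: for smooth
`u₁, u₂, δ : T^d → ℝ^d` with `‖u₁‖ ≤ M`, `‖∂ₖu₁‖ ≤ Λ`, `‖∂ₖu₂‖ ≤ Λ`, `‖δ‖ ≤ M₀` pointwise, the field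
`V = (u₁·∇)δ + (δ·∇)u₂` satisfies
`‖V‖₂² + ‖∇V‖₂² ≤ 2d²Λ² ‖δ‖₂² + (2dM² + 8d²Λ²) ‖∇δ‖₂² + 4dM² ‖Δδ‖₂² + 4dM₀² ‖Δu₂‖₂²`
(`Torus.integral_norm_sq_convect_add_convect_le`, `Torus.gradNormSq_add_le`, and the transport / stretching
shapes `Torus.gradNormSq_convect_le_of_norm_left_le`, `Torus.gradNormSq_convect_le_of_norm_right_le`; the
`H¹`-level instance of the `H^k(T³)` product estimates, Robinson–Rodrigo–Sadowski 2016, proof of Thm 7.1 (7.3)).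
[cite: RobinsonRodrigoSadowskiCUP2016, proof of Thm 7.1 (7.3)] -/
theorem h1_convect_add_convect_le {δ : UnitAddTorus d → EuclideanSpace ℝ d} (hu₁ : IsSmooth u₁) (hu₂ : IsSmooth u₂)
    (hδ : IsSmooth δ) {M Λ M₀ : ℝ} (hM : ∀ x, ‖u₁ x‖ ≤ M) (hΛ₁ : ∀ (k : d) (x : UnitAddTorus d), ‖partialDeriv k u₁ x‖ ≤ Λ)
    (hΛ₂ : ∀ (k : d) (x : UnitAddTorus d), ‖partialDeriv k u₂ x‖ ≤ Λ) (hM₀ : ∀ x, ‖δ x‖ ≤ M₀) :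
    (∫ x, ‖convect u₁ δ x + convect δ u₂ x‖ ^ 2) + gradNormSq (fun x => convect u₁ δ x + convect δ u₂ x) ≤
      2 * Fintype.card d ^ 2 * Λ ^ 2 * (∫ x, ‖δ x‖ ^ 2) +
        (2 * Fintype.card d * M ^ 2 + 8 * Fintype.card d ^ 2 * Λ ^ 2) * gradNormSq δ +
        4 * Fintype.card d * M ^ 2 * (∫ x, ‖laplacian δ x‖ ^ 2) +
        4 * Fintype.card d * M₀ ^ 2 * (∫ x, ‖laplacian u₂ x‖ ^ 2) := by
  have hL2 := integral_norm_sq_convect_add_convect_le (u₁ := u₁) hu₂ hδ hM (C := fun _ => Λ) fun i x => hΛ₂ i x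
  have hsum : (∑ _i : d, Λ) = Fintype.card d * Λ := by
    rw [Finset.sum_const, Finset.card_univ, nsmul_eq_mul]
  rw [hsum] at hL2
  have hA := gradNormSq_convect_le_of_norm_left_le hu₁ hδ hM hΛ₁
  have hB := gradNormSq_convect_le_of_norm_right_le hδ hu₂ hM₀ hΛ₂
  have hs := gradNormSq_add_le (hu₁.convect hδ) (hδ.convect hu₂)
  have he : (fun x => convect u₁ δ x + convect δ u₂ x) = convect u₁ δ + convect δ u₂ := rfl
  rw [he]
  nlinarith [hL2, hA, hB, hs]

/-- `Torus.h1_convect_add_convect_le` on `T³` (`card d = 3`), numerical constants evaluated: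
`‖V‖₂² + ‖∇V‖₂² ≤ 18Λ² ‖δ‖₂² + (6M² + 72Λ²) ‖∇δ‖₂² + 12M² ‖Δδ‖₂² + 12M₀² ‖Δu₂‖₂²`.
[cite: RobinsonRodrigoSadowskiCUP2016, proof of Thm 7.1 (7.3)] -/
theorem h1_convect_add_convect_le_three (hd : Fintype.card d = 3) {δ : UnitAddTorus d → EuclideanSpace ℝ d}
    (hu₁ : IsSmooth u₁) (hu₂ : IsSmooth u₂) (hδ : IsSmooth δ) {M Λ M₀ : ℝ} (hM : ∀ x, ‖u₁ x‖ ≤ M)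
    (hΛ₁ : ∀ (k : d) (x : UnitAddTorus d), ‖partialDeriv k u₁ x‖ ≤ Λ)
    (hΛ₂ : ∀ (k : d) (x : UnitAddTorus d), ‖partialDeriv k u₂ x‖ ≤ Λ) (hM₀ : ∀ x, ‖δ x‖ ≤ M₀) :
    (∫ x, ‖convect u₁ δ x + convect δ u₂ x‖ ^ 2) + gradNormSq (fun x => convect u₁ δ x + convect δ u₂ x) ≤
      18 * Λ ^ 2 * (∫ x, ‖δ x‖ ^ 2) + (6 * M ^ 2 + 72 * Λ ^ 2) * gradNormSq δ +
        12 * M ^ 2 * (∫ x, ‖laplacian δ x‖ ^ 2) + 12 * M₀ ^ 2 * (∫ x, ‖laplacian u₂ x‖ ^ 2) := by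
  have h := h1_convect_add_convect_le hu₁ hu₂ hδ hM hΛ₁ hΛ₂ hM₀
  have h3 : (Fintype.card d : ℝ) = 3 := by rw [hd]; norm_num
  rw [h3] at h
  linarith

end VectorField

/-! ### High Sobolev norms on a Gevrey ball -/

section Gevrey

variable {σ C : ℝ} {v : UnitAddTorus d → EuclideanSpace ℝ d}

/-- **`‖∇Δ²v‖₂²` on a Gevrey ball**: if `∑_{k∈S} e^{2σ|k|} ‖v̂(k)‖² ≤ C` for all finite `S` (`σ > 0`) then
`gradNormSq (Δ²v) ≤ (4π²)⁵ · C · ∑ₖ (1 + |k|²)⁵ e^{−2σ|k|}` (the fifth spectral moment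
`∑ (4π²|k|²)⁵ ‖v̂‖² = ‖∇Δ²v‖₂²`, `|k|² ≤ 1 + |k|²`, and the Sobolev sums of a Gevrey bound,
`Torus.sum_one_add_freqNormSq_pow_mul_norm_sq_le_of_gevreyBound`; Foias–Temam 1989 Gevrey classes). [folklore] -/
theorem gradNormSq_laplacian_laplacian_le_of_gevreyBound (hσ : 0 < σ) (hv : IsSmooth v)
    (h : ∀ S : Finset (d → ℤ), ∑ k ∈ S, Real.exp (2 * σ * Real.sqrt (freqNormSq k)) *
      ‖mFourierCoeff (EuclideanSpace.complexify ∘ v) k‖ ^ 2 ≤ C) :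
    gradNormSq (laplacian (laplacian v)) ≤ (4 * Real.pi ^ 2) ^ 5 *
      (C * ∑' k : d → ℤ, (1 + freqNormSq k) ^ 5 * Real.exp (-(2 * σ * Real.sqrt (freqNormSq k)))) := by
  refine hasSum_le_of_sum_le (hasSum_laplacianSymbol_pow_five_mul_norm_sq_mFourierCoeff hv) fun S => ?_
  have hterm : ∀ k : d → ℤ, (4 * Real.pi ^ 2 * freqNormSq k) ^ 5 *
      ‖mFourierCoeff (EuclideanSpace.complexify ∘ v) k‖ ^ 2 ≤
      (4 * Real.pi ^ 2) ^ 5 * ((1 + freqNormSq k) ^ 5 * ‖mFourierCoeff (EuclideanSpace.complexify ∘ v) k‖ ^ 2) := by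
    intro k
    have h0 : 0 ≤ freqNormSq k := freqNormSq_nonneg k
    have h1 : freqNormSq k ^ 5 ≤ (1 + freqNormSq k) ^ 5 := pow_le_pow_left₀ h0 (by linarith) 5
    rw [mul_pow, mul_assoc]
    exact mul_le_mul_of_nonneg_left (mul_le_mul_of_nonneg_right h1 (sq_nonneg _)) (by positivity)
  calc ∑ k ∈ S, (4 * Real.pi ^ 2 * freqNormSq k) ^ 5 * ‖mFourierCoeff (EuclideanSpace.complexify ∘ v) k‖ ^ 2
      ≤ ∑ k ∈ S, (4 * Real.pi ^ 2) ^ 5 *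
          ((1 + freqNormSq k) ^ 5 * ‖mFourierCoeff (EuclideanSpace.complexify ∘ v) k‖ ^ 2) :=
        Finset.sum_le_sum fun k _ => hterm k
    _ = (4 * Real.pi ^ 2) ^ 5 * ∑ k ∈ S, (1 + freqNormSq k) ^ 5 * ‖mFourierCoeff (EuclideanSpace.complexify ∘ v) k‖ ^ 2 := by
        rw [Finset.mul_sum]
    _ ≤ _ := mul_le_mul_of_nonneg_left (sum_one_add_freqNormSq_pow_mul_norm_sq_le_of_gevreyBound hσ h 5 S)
        (by positivity)

end Gevrey

/-! ### The estimate on `T³` -/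

section Three

/-- **The real-variable bookkeeping of the Hölder estimate** (steps 3–4 of the file header, with all
function-space quantities replaced by real numbers): if `lhs ≤ 2ν²(Y + Z) + 2V`,
`V ≤ 18B²L + (6B² + 72B²)E + 12B²Y + 12·M·W` with `M = K₃(E + Y)`, `W ≤ B`, the ball bounds
`L ≤ 4B²`, `E ≤ 4B`, `Z ≤ 4B`, `Z₅ ≤ 4B₅`, and the interpolations `Y ≤ √E √Z`, `Z ≤ √E √Z₅`, then
`lhs ≤ (2ν² + 2(78B² + 12K₃B)) (√(4B² + 4B) + √(4B) + √(4B₅)) √(L + E)` (`h² ≤ h_max h`). [folklore] -/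
theorem holder_bookkeeping {lhs L E Y Z Z₅ V W M B B₅ K₃ ν : ℝ} (hL0 : 0 ≤ L) (hE0 : 0 ≤ E) (hY0 : 0 ≤ Y)
    (hZ0 : 0 ≤ Z) (hB0 : 0 ≤ B) (hK₃ : 0 ≤ K₃)
    (hstep2 : lhs ≤ 2 * ν ^ 2 * (Y + Z) + 2 * V)
    (hstep3 : V ≤ 18 * B ^ 2 * L + (6 * B ^ 2 + 72 * B ^ 2) * E + 12 * B ^ 2 * Y + 12 * M * W)
    (hM : M = K₃ * (E + Y)) (hW : W ≤ B) (hLle : L ≤ 4 * B ^ 2) (hEle : E ≤ 4 * B) (hZle : Z ≤ 4 * B)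
    (hZ₅le : Z₅ ≤ 4 * B₅) (hYi : Y ≤ Real.sqrt E * Real.sqrt Z) (hZi : Z ≤ Real.sqrt E * Real.sqrt Z₅) :
    lhs ≤ (2 * ν ^ 2 + 2 * (78 * B ^ 2 + 12 * K₃ * B)) *
      (Real.sqrt (4 * B ^ 2 + 4 * B) + Real.sqrt (4 * B) + Real.sqrt (4 * B₅)) * Real.sqrt (L + E) := by
  set KV : ℝ := 78 * B ^ 2 + 12 * K₃ * B with hKV
  have hKV0 : 0 ≤ KV := by positivity
  set K₀ : ℝ := 2 * ν ^ 2 + 2 * KV with hK₀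
  have hK₀0 : 0 ≤ K₀ := by positivity
  have hprod : 12 * M * W ≤ 12 * (K₃ * (E + Y)) * B := by
    rw [hM]; exact mul_le_mul_of_nonneg_left hW (by positivity)
  have hV : V ≤ KV * (L + E + Y) := by
    rw [hKV]; nlinarith [hstep3, hprod, sq_nonneg B, mul_nonneg hK₃ hB0]
  have hmain : lhs ≤ K₀ * (L + E + Y + Z) := by
    rw [hK₀]; nlinarith [hstep2, hV, sq_nonneg ν, mul_nonneg hKV0 hZ0, mul_nonneg (sq_nonneg ν) (add_nonneg hL0 hE0)]
  -- interpolation down to `H¹`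
  set h : ℝ := Real.sqrt (L + E) with hh
  have hh0 : 0 ≤ h := Real.sqrt_nonneg _
  have hhsq : h * h = L + E := Real.mul_self_sqrt (by positivity)
  have hsqrtE : Real.sqrt E ≤ h := Real.sqrt_le_sqrt (by linarith)
  have hLE : L + E ≤ Real.sqrt (4 * B ^ 2 + 4 * B) * h := by
    rw [← hhsq]; exact mul_le_mul_of_nonneg_right (Real.sqrt_le_sqrt (by linarith)) hh0
  have hYle : Y ≤ Real.sqrt (4 * B) * h :=
    calc Y ≤ Real.sqrt E * Real.sqrt Z := hYi
      _ ≤ h * Real.sqrt (4 * B) := mul_le_mul hsqrtE (Real.sqrt_le_sqrt hZle) (Real.sqrt_nonneg _) hh0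
      _ = Real.sqrt (4 * B) * h := mul_comm _ _
  have hZle' : Z ≤ Real.sqrt (4 * B₅) * h :=
    calc Z ≤ Real.sqrt E * Real.sqrt Z₅ := hZi
      _ ≤ h * Real.sqrt (4 * B₅) := mul_le_mul hsqrtE (Real.sqrt_le_sqrt hZ₅le) (Real.sqrt_nonneg _) hh0
      _ = Real.sqrt (4 * B₅) * h := mul_comm _ _
  have hfin : K₀ * (L + E + Y + Z) ≤
      K₀ * (Real.sqrt (4 * B ^ 2 + 4 * B) + Real.sqrt (4 * B) + Real.sqrt (4 * B₅)) * h := by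
    rw [mul_assoc]
    refine mul_le_mul_of_nonneg_left ?_ hK₀0
    nlinarith [hLE, hYle, hZle']
  exact hmain.trans hfin

/-- **Hölder-½ continuity in `H¹` of the projected Navier–Stokes vector field on a Gevrey ball of `T³`.**
On `T^d` with `card d = 3`: for all real `ν, σ, C` with `σ > 0` there is `K = K(ν, σ, C, d)` such that for
all smooth zero-mean `u₁, u₂ : T^d → ℝ^d` obeying the Gevrey bound `∑_{k∈S} e^{2σ|k|} ‖ûⱼ(k)‖² ≤ C` (all
finite `S`), the field `G(u) = νΔu − P((u·∇)u)`, `P v = v − ∇Δ⁻¹div v`, satisfies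
`∫ ‖G(u₁) − G(u₂)‖² + gradNormSq (G(u₁) − G(u₂)) ≤ K · (∫ ‖u₁ − u₂‖² + gradNormSq (u₁ − u₂))^{1/2}`.
Proof: steps 1–4 of the file header (`Torus.h1_nsVectorField_sub_le`, `Torus.h1_convect_add_convect_le_three`,
the Gevrey sup/Sobolev bounds, the `T³` sup bound of the zero-mean difference, the interpolations of
`TorusSobolevInterpolationCS`, and the real-variable bookkeeping `Torus.holder_bookkeeping`; Robinson–Rodrigo–Sadowski
2016, proof of Thm 7.1; Constantin–Foias 1988, Ch. 4–6). [folklore] -/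
theorem exists_h1_nsVectorField_sub_le_sqrt_of_gevreyBound (hd : Fintype.card d = 3) (ν σ C : ℝ) (hσ : 0 < σ) :
    ∃ K : ℝ, ∀ (u₁ u₂ : UnitAddTorus d → EuclideanSpace ℝ d), IsSmooth u₁ → IsSmooth u₂ →
      HasZeroMean u₁ → HasZeroMean u₂ →
      (∀ S' : Finset (d → ℤ), ∑ k ∈ S', Real.exp (2 * σ * Real.sqrt (freqNormSq k)) *
        ‖mFourierCoeff (EuclideanSpace.complexify ∘ u₁) k‖ ^ 2 ≤ C) →
      (∀ S' : Finset (d → ℤ), ∑ k ∈ S', Real.exp (2 * σ * Real.sqrt (freqNormSq k)) *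
        ‖mFourierCoeff (EuclideanSpace.complexify ∘ u₂) k‖ ^ 2 ≤ C) →
      (∫ x, ‖(ν • laplacian u₁ x - (convect u₁ u₁ x - Torus.gradient (invLaplacian (divergence (convect u₁ u₁))) x)) -
          (ν • laplacian u₂ x - (convect u₂ u₂ x - Torus.gradient (invLaplacian (divergence (convect u₂ u₂))) x))‖ ^ 2) +
        gradNormSq (fun x => (ν • laplacian u₁ x -
            (convect u₁ u₁ x - Torus.gradient (invLaplacian (divergence (convect u₁ u₁))) x)) -
          (ν • laplacian u₂ x - (convect u₂ u₂ x - Torus.gradient (invLaplacian (divergence (convect u₂ u₂))) x))) ≤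
        K * Real.sqrt ((∫ x, ‖u₁ x - u₂ x‖ ^ 2) + gradNormSq (u₁ - u₂)) := by
  haveI : Nonempty d := Fintype.card_pos_iff.1 (by rw [hd]; norm_num)
  obtain ⟨B, hB⟩ := exists_sobolevBounds_of_gevreyBound (d := d) hσ C
  obtain ⟨K₃, hK₃, hsup⟩ := norm_sq_le_gradNormSq_add_of_hasZeroMean (d := d) hd
  refine ⟨(2 * ν ^ 2 + 2 * (78 * B ^ 2 + 12 * K₃ * B)) *
      (Real.sqrt (4 * B ^ 2 + 4 * B) + Real.sqrt (4 * B) + Real.sqrt (4 * ((4 * Real.pi ^ 2) ^ 5 *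
        (C * ∑' k : d → ℤ, (1 + freqNormSq k) ^ 5 * Real.exp (-(2 * σ * Real.sqrt (freqNormSq k))))))),
    fun u₁ u₂ hu₁ hu₂ hm₁ hm₂ hG₁ hG₂ => ?_⟩
  obtain ⟨h0₁, h1₁, hE₁, -, hZ₁, -⟩ := hB u₁ hu₁ hG₁
  obtain ⟨h0₂, h1₂, hE₂, hY₂, hZ₂, -⟩ := hB u₂ hu₂ hG₂
  have hB0 : 0 ≤ B := (norm_nonneg _).trans (h0₁ 0)
  -- the difference `δ = u₁ - u₂`
  have hδ : IsSmooth (fun y => u₁ y - u₂ y) := hu₁.sub hu₂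
  have hδ0 : HasZeroMean (fun y => u₁ y - u₂ y) := by
    rw [HasZeroMean] at hm₁ hm₂ ⊢
    rw [integral_sub hu₁.integrable hu₂.integrable, hm₁, hm₂, sub_zero]
  have hΔδ : laplacian (fun y => u₁ y - u₂ y) = fun x => laplacian u₁ x - laplacian u₂ x := laplacian_sub hu₁ hu₂
  have hΔΔδ : laplacian (laplacian (fun y => u₁ y - u₂ y)) =
      fun x => laplacian (laplacian u₁) x - laplacian (laplacian u₂) x := by
    rw [hΔδ]; exact laplacian_sub hu₁.laplacian hu₂.laplacian
  -- nonnegativity and ball bounds of the norms of `δ`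
  have hL0 : 0 ≤ ∫ x, ‖u₁ x - u₂ x‖ ^ 2 := integral_nonneg fun x => sq_nonneg _
  have hE0 : 0 ≤ gradNormSq (fun y => u₁ y - u₂ y) := gradNormSq_nonneg _
  have hY0 : 0 ≤ ∫ x, ‖laplacian (fun y => u₁ y - u₂ y) x‖ ^ 2 := integral_nonneg fun x => sq_nonneg _
  have hZ0 : 0 ≤ gradNormSq (laplacian (fun y => u₁ y - u₂ y)) := gradNormSq_nonneg _
  have hLle : (∫ x, ‖u₁ x - u₂ x‖ ^ 2) ≤ 4 * B ^ 2 := by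
    linarith [integral_norm_sq_fun_sub_le hu₁ hu₂, integral_norm_sq_le_of_forall_norm_le h0₁,
      integral_norm_sq_le_of_forall_norm_le h0₂]
  have hEle : gradNormSq (fun y => u₁ y - u₂ y) ≤ 4 * B := by linarith [gradNormSq_fun_sub_le hu₁ hu₂]
  have hZle : gradNormSq (laplacian (fun y => u₁ y - u₂ y)) ≤ 4 * B := by
    rw [hΔδ]; linarith [gradNormSq_fun_sub_le hu₁.laplacian hu₂.laplacian]
  have hZ₅le : gradNormSq (laplacian (laplacian (fun y => u₁ y - u₂ y))) ≤ 4 * ((4 * Real.pi ^ 2) ^ 5 *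
      (C * ∑' k : d → ℤ, (1 + freqNormSq k) ^ 5 * Real.exp (-(2 * σ * Real.sqrt (freqNormSq k))))) := by
    rw [hΔΔδ]
    linarith [gradNormSq_fun_sub_le hu₁.laplacian.laplacian hu₂.laplacian.laplacian,
      gradNormSq_laplacian_laplacian_le_of_gevreyBound hσ hu₁ hG₁,
      gradNormSq_laplacian_laplacian_le_of_gevreyBound hσ hu₂ hG₂]
  -- the sup bound of the zero-mean difference on `T³`, and steps 2–3
  have hEY0 : 0 ≤ K₃ * (gradNormSq (fun y => u₁ y - u₂ y) + ∫ x, ‖laplacian (fun y => u₁ y - u₂ y) x‖ ^ 2) :=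
    mul_nonneg hK₃.le (add_nonneg hE0 hY0)
  have hM₀b : ∀ x, ‖(fun y => u₁ y - u₂ y) x‖ ≤
      Real.sqrt (K₃ * (gradNormSq (fun y => u₁ y - u₂ y) + ∫ x, ‖laplacian (fun y => u₁ y - u₂ y) x‖ ^ 2)) :=
    fun x => Real.le_sqrt_of_sq_le (hsup _ hδ hδ0 x)
  have hstep2 := h1_nsVectorField_sub_le ν hu₁ hu₂
  have hstep3 := h1_convect_add_convect_le_three hd hu₁ hu₂ hδ h0₁ h1₁ h1₂ hM₀b
  rw [show u₁ - u₂ = fun y => u₁ y - u₂ y from rfl]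
  exact holder_bookkeeping hL0 hE0 hY0 hZ0 hB0 hK₃.le hstep2 hstep3 (Real.sq_sqrt hEY0) hY₂ hLle hEle
    hZle hZ₅le (integral_norm_laplacian_sq_le_sqrt_mul_sqrt hδ)
    (gradNormSq_laplacian_le_sqrt_gradNormSq_mul_sqrt_gradNormSq hδ)

end Three

end Torus

end Literature.Analysis.FluidPDE

end
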